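import Summits.CriticalPhenomena.PercolationContinuityZ3.Theorems.FK.ShellBlackCluster
import Literature.Probability.Percolation.PercolationEvents
import HarnessLib

/-!
# FK-continuity cell, FO-10a: THE WHITE `★`-SLEEVE, III — the cavity of the origin is characterised by its sleeve
# (Grimmett's claims (a)–(c): `D(B(∂Δ))` is connected, white, and measurable w.r.t. the colours outside the cavity)

Claimed R42 (8)(c) in the cell INBOX at 2026-08-27T01:41:06Z by fkp-10a gen 347 under provision (ι) (coordinator unit fk-4 lapsed 2026-08-26T11:30Z; g242 re-seated 20:28Z–23:50Z 2026-08-26 and closed l.7916; the lane lead absorbs the registry word; silence = consent); lineage row FO-10a-g347, package g347-uniqueness, label UQ-D.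
Cell `fk-continuity` (bschramm), row FO-10a; support file for the FK-continuity transplant
(`--supports stmt-CriticalPhenomena-4575`); builds on p205010 (kernel theorem, internal audit signed; external expert
review pending). Pure proofs; no definitions, no named facts, no sorries; standard axioms. Deterministic (no
measure); continues `ShellBlackCluster.lean`.

Grimmett 2006, §5.3, proof of Thm. (5.33)(b) (p. 109): with `S = B(∂Δ)` the black cluster, the 'internal boundary'
`D(S)` and the cavity `I(S) ∋ Λ`, one needs: (a) `D(S)` is connected, (b) white, (c) "`{B(∂Δ) = h, D(B(∂Δ)) = D(h)}` lies
in the σ-field generated by the colours of vertices in `I(h)ᶜ`" — "Full proofs of (a) and (c) are not given here. They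
would be rather long". This file gives them for the block colouring of `WhiteSleeveWiring.lean` (a site is BLACK when
some lattice edge with an endpoint in its `★`-ball `B∞(·,1)` is closed), with the sleeve taken on the `★`-side where
Friedli–Velenik's Lemma B.82 applies. With `B` an arbitrary set of black sites, `S` the black cluster of the shell
`Λ_{N+1} ∖ Λ_N` (hypothesis `hS` of `ShellBlackCluster.lean`) and `K = starIntComp S 0` the **cavity of the origin**, the
**sleeve event of a candidate cavity `K₀`** is the conjunction, written out in every statement: `K₀` and `K₀ᶜ` are
`★`-connected, `0 ∈ K₀ ⊆ Λ_N`, every site of `∂^in_★ K₀` is white, and every site of `∂^ex_★ K₀` is `★`-chained to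
`Λ_Nᶜ` through sites of `K₀ᶜ ∩ Bk` (`Bk` = black-or-outside-`Λ_N`). Proved:

* **characterisation**: the sleeve event of `K₀` holds iff `K₀` is the cavity of the origin (`sleeve_of_cavity` ⇐ —
  Grimmett's (a), (b) via Friedli–Velenik Lemma 7.19 / Exercise 7.11 — and `cavity_eq_of_sleeve` ⇒);
* hence the sleeve events of distinct candidates are DISJOINT (`disjoint_setOf_sleeve`); they are DETERMINED BY THE
  COLOURS OF THE LAYER `(Λ_N ∖ K₀) ∪ ∂^in_★ K₀`, i.e. by the lattice edges with an endpoint in a `★`-ball of that layer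
  (`determinedBy_setOf_sleeve` — claim (c); local, `isLocalEvent_setOf_sleeve`), a set of edges disjoint from
  `E(core K₀)` by `WhiteSleeveWiring.disjoint_biUnion_edgesTouching_starBall_edgesIn_core` (`layer_subset`);
* **covering** (`setOf_forall_not_chain_subset_biUnion_sleeve`): if no site of `Λ_{m+2}` is black-chained to `Λ_Nᶜ`
  (Grimmett's `K_{Λ,Δ}`), the configuration lies in the sleeve event of a candidate `K₀` with `Λ_{m+2} ⊆ K₀ ⊆ Λ_N`.

## References

* G. Grimmett, *The Random-Cluster Model*, Springer 2006 (`book:grimmett2006-random-cluster-model`): §5.3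
  Thm. (5.33)(b), proof sketch pp. 108–110 (D(S), I(S), claims (a)–(c), (5.37)–(5.38)). [Grimmett2006]
* S. Friedli, Y. Velenik, *Statistical Mechanics of Lattice Systems*, CUP 2017: §7.2.6 (Exercise 7.11, Lemma 7.19),
  App. B.15 Lemma B.82. [FriedliVelenik2017]
* H. Kesten, *Aspects of first passage percolation*, LNM 1180 (1986), §2 (Grimmett's [211]). [Kesten1986StFlour]
-/

noncomputable section

open Finset SimpleGraph Relation

namespace Summit.CriticalPhenomena.PercolationContinuityZ3.Theorems.FK

open Literature.Probability.Percolation Literature.Probability.LatticeModels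

variable {d : ℕ}

/-! ### The characterisation of the cavity of the origin by its sleeve -/

section Cavity

variable {N : ℕ} {B : Set (Site d)} {S K₀ : Finset (Site d)}

/-- **The cavity satisfies its sleeve conditions** (Grimmett's (a)–(c), the `⇐` half of the characterisation). Let `S`
be the black cluster of the shell of `Λ_{N+1}` (`d ≥ 2`), `0 ∉ S`, and `K = starIntComp S 0` the cavity of the origin.
Then `K` and `Kᶜ` are `★`-connected, `0 ∈ K ⊆ Λ_N`, every site of `∂^in_★ K` is white, and every site of `∂^ex_★ K` is
`★`-chained to `Λ_Nᶜ` through black-or-outside sites OFF `K`. [cite: Grimmett2006, §5.3 proof of Thm. (5.33)(b), claims (a)–(c) p. 109] -/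
theorem sleeve_of_cavity (hd : 2 ≤ d)
    (hS : ∀ z, z ∈ S ↔ z ∈ box d (N + 1) ∧ ∃ y, y ∉ box d N ∧ ReflTransGen (starRel {w | w ∉ box d N ∨ w ∈ B}) z y)
    (h0 : (0 : Site d) ∉ S) :
    StarConn (↑(starIntComp S 0) : Set (Site d)) ∧ StarConn (↑(starIntComp S 0) : Set (Site d))ᶜ ∧
      (0 : Site d) ∈ starIntComp S 0 ∧ starIntComp S 0 ⊆ box d N ∧
      (∀ x ∈ inBoundary (starIntComp S 0), x ∉ B) ∧
      ∀ y ∈ exBoundary (starIntComp S 0), ∃ y', y' ∉ box d N ∧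
        ReflTransGen (starRel {w | w ∉ starIntComp S 0 ∧ (w ∉ box d N ∨ w ∈ B)}) y y' := by
  have hSbox := blackCluster_subset_box hS
  have hshell : box d (N + 1) \ box d N ⊆ S := fun z hz => mem_blackCluster_of_mem_shell hS hz
  have h0int : (0 : Site d) ∈ starInt S := mem_starInt_of_shell_subset hd hSbox hshell (zero_mem_box d N) h0
  set K := starIntComp S 0 with hK
  have hKbox : K ⊆ box d N := starIntComp_subset_box hd hSbox hshell 0
  have hKS : ∀ x ∈ K, x ∉ S := fun x hx => ((mem_starInt hd).1 (starIntComp_subset S 0 hx)).1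
  -- a `★`-neighbour off `K` of a site of `K` lies in `S`
  have hnbr : ∀ {x y : Site d}, x ∈ K → y ∉ K → (zdStar d).Adj x y → y ∈ S := by
    intro x y hx hy hxy
    by_contra hyS
    exact hy (mem_starIntComp_of_starRel hd h0int hx ⟨hxy, hKS x hx, hyS⟩)
  -- the sleeve is white
  have hwhite : ∀ x ∈ inBoundary K, x ∉ B := by
    intro x hx hxB
    obtain ⟨hxK, y, hyK, hxy⟩ := mem_inBoundary.1 hx
    have hyS : y ∈ S := hnbr hxK hyK hxy
    exact hKS x hxK (mem_blackCluster_of_adj hS (box_mono d (Nat.le_succ N) (hKbox hxK)) (Or.inr hxB) hyS hxy)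
  refine ⟨starConn_starIntComp hd h0int, starConn_compl_starIntComp hd (starConn_blackCluster hd hS) h0int,
    mem_starIntComp_self hd h0int, hKbox, hwhite, fun y hy => ?_⟩
  obtain ⟨hyK, x, hxK, hxy⟩ := mem_exBoundary.1 hy
  have hyS : y ∈ S := hnbr hxK hyK hxy
  obtain ⟨-, y', hy', hchain⟩ := (hS y).1 hyS
  -- the black chain of `y` avoids `K`: a black-or-outside site `★`-adjacent to a site off `K` is off `K`
  have hclosed : ∀ a ∈ ({w | w ∉ box d N ∨ w ∈ B} ∩ (↑K : Set (Site d))ᶜ), ∀ b,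
      starRel {w | w ∉ box d N ∨ w ∈ B} a b → b ∈ ({w | w ∉ box d N ∨ w ∈ B} ∩ (↑K : Set (Site d))ᶜ) := by
    intro a ha b hab
    refine ⟨hab.2.2, fun hbK => ?_⟩
    rcases hab.2.2 with hbN | hbB
    · exact hbN (hKbox hbK)
    · exact hwhite b (mem_inBoundary.2 ⟨hbK, a, ha.2, hab.1.symm⟩) hbB
  have hyBk : y ∈ ({w | w ∉ box d N ∨ w ∈ B} ∩ (↑K : Set (Site d))ᶜ) := by
    refine ⟨?_, hyK⟩
    by_cases hyN : y ∈ box d N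
    · exact Or.inr (mem_black_of_mem_blackCluster hS hyS hyN)
    · exact Or.inl hyN
  exact ⟨y', hy', reflTransGen_starRel_mono (fun w hw => And.intro hw.2 hw.1) (reflTransGen_starRel_restrict hclosed hyBk hchain)⟩

/-- **A candidate satisfying the sleeve conditions IS the cavity** (the `⇒` half): if `K₀`, `0 ∈ K₀ ⊆ Λ_N`, is
`★`-connected, every site of `∂^in_★ K₀` is white and every site of `∂^ex_★ K₀` is `★`-chained to `Λ_Nᶜ` through
black-or-outside sites off `K₀`, then `0 ∉ S` and `starIntComp S 0 = K₀`. (No black chain enters `K₀`: its entry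
point would be a black site of the white sleeve; so `K₀ ⊆` the cavity; conversely a chain in `Sᶜ` leaving `K₀` exits
through `∂^ex_★ K₀ ⊆ S`.) [cite: Grimmett2006, §5.3 proof of Thm. (5.33)(b), claim (c) p. 109] -/
theorem cavity_eq_of_sleeve (hd : 2 ≤ d)
    (hS : ∀ z, z ∈ S ↔ z ∈ box d (N + 1) ∧ ∃ y, y ∉ box d N ∧ ReflTransGen (starRel {w | w ∉ box d N ∨ w ∈ B}) z y)
    (hconn : StarConn (↑K₀ : Set (Site d))) (h0 : (0 : Site d) ∈ K₀) (hK₀N : K₀ ⊆ box d N)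
    (hwhite : ∀ x ∈ inBoundary K₀, x ∉ B)
    (hex : ∀ y ∈ exBoundary K₀, ∃ y', y' ∉ box d N ∧
      ReflTransGen (starRel {w | w ∉ K₀ ∧ (w ∉ box d N ∨ w ∈ B)}) y y') :
    (0 : Site d) ∉ S ∧ starIntComp S 0 = K₀ := by
  have hSbox := blackCluster_subset_box hS
  have hshell : box d (N + 1) \ box d N ⊆ S := fun z hz => mem_blackCluster_of_mem_shell hS hz
  -- Step 1: no site of `K₀` is in the black cluster
  have hdisj : ∀ x ∈ K₀, x ∉ S := by
    intro x hxK hxS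
    obtain ⟨-, y, hy, hchain⟩ := (hS x).1 hxS
    have hyK : y ∉ (↑K₀ : Set (Site d)) := fun h => hy (hK₀N (mem_coe.1 h))
    obtain ⟨a, b, ha, hb, hab, -⟩ := exists_starRel_exit hchain (mem_coe.2 hxK) hyK
    have haB : a ∈ B := by
      rcases hab.2.1 with haN | haB
      · exact absurd (hK₀N (mem_coe.1 ha)) haN
      · exact haB
    exact hwhite a (mem_inBoundary.2 ⟨mem_coe.1 ha, b, fun h => hb (mem_coe.2 h), hab.1⟩) haB
  have h0S : (0 : Site d) ∉ S := hdisj 0 h0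
  have h0int : (0 : Site d) ∈ starInt S := mem_starInt_of_shell_subset hd hSbox hshell (zero_mem_box d N) h0S
  refine ⟨h0S, Finset.Subset.antisymm ?_ ?_⟩
  · -- Step 4: the cavity does not leave `K₀`
    intro z hz
    have hchain := (mem_starIntComp hd h0int).1 hz
    by_contra hzK
    obtain ⟨a, b, ha, hb, hab, -⟩ := exists_starRel_exit (R := (↑K₀ : Set (Site d))) hchain (mem_coe.2 h0) (fun h => hzK (mem_coe.1 h))
    have hbex : b ∈ exBoundary K₀ := mem_exBoundary.2 ⟨fun h => hb (mem_coe.2 h), a, mem_coe.1 ha, hab.1⟩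
    obtain ⟨y', hy', hby'⟩ := hex b hbex
    have hb1 : b ∈ box d (N + 1) := mem_box_succ_of_supDist_le_one (hK₀N (mem_coe.1 ha)) (zdStar_adj.1 hab.1).2
    have hbS : b ∈ S := (hS b).2 ⟨hb1, y', hy', reflTransGen_starRel_mono (fun w hw => hw.2) hby'⟩
    exact hab.2.2 (mem_coe.2 hbS)
  · -- Step 3: `K₀` is `★`-connected, avoids `S`, contains `0`
    have hsub := subset_starIntComp_of_starConn hd hconn
      (Set.disjoint_left.2 fun x hx hxS => hdisj x (mem_coe.1 hx) (mem_coe.1 hxS)) (mem_coe.2 h0) h0int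
    exact fun z hz => mem_coe.1 (hsub (mem_coe.2 hz))

end Cavity
/-! ### The sleeve events of a configuration: disjoint, determined by the colours of the outer layer, covering -/

section Events

variable {N : ℕ}

/-- **The sleeve events of distinct candidates are disjoint**: a configuration whose black sites satisfy the sleeve
conditions of `K₀` has cavity `K₀` (`cavity_eq_of_sleeve`). [cite: Grimmett2006, §5.3 proof of Thm. (5.33)(b) (summing over h ∈ 𝓗_Λ)] -/
theorem disjoint_setOf_sleeve (hd : 2 ≤ d) {K₀ K₀' : Finset (Site d)} (hne : K₀ ≠ K₀') :
    Disjoint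
      {ω : BondConfig (Site d) | StarConn (↑K₀ : Set (Site d)) ∧ StarConn (↑K₀ : Set (Site d))ᶜ ∧ (0 : Site d) ∈ K₀ ∧
        K₀ ⊆ box d N ∧ (∀ x ∈ inBoundary K₀, ∀ e ∈ edgesTouching (zdGraph d) (starBall x), e ∈ ω) ∧
        ∀ y ∈ exBoundary K₀, ∃ y', y' ∉ box d N ∧ ReflTransGen (starRel {w | w ∉ K₀ ∧
          (w ∉ box d N ∨ ∃ e ∈ edgesTouching (zdGraph d) (starBall w), e ∉ ω)}) y y'}
      {ω : BondConfig (Site d) | StarConn (↑K₀' : Set (Site d)) ∧ StarConn (↑K₀' : Set (Site d))ᶜ ∧ (0 : Site d) ∈ K₀' ∧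
        K₀' ⊆ box d N ∧ (∀ x ∈ inBoundary K₀', ∀ e ∈ edgesTouching (zdGraph d) (starBall x), e ∈ ω) ∧
        ∀ y ∈ exBoundary K₀', ∃ y', y' ∉ box d N ∧ ReflTransGen (starRel {w | w ∉ K₀' ∧
          (w ∉ box d N ∨ ∃ e ∈ edgesTouching (zdGraph d) (starBall w), e ∉ ω)}) y y'} := by
  classical
  rw [Set.disjoint_left]
  rintro ω ⟨h1, -, h3, h4, h5, h6⟩ ⟨h1', -, h3', h4', h5', h6'⟩
  set B : Set (Site d) := {w | ∃ e ∈ edgesTouching (zdGraph d) (starBall w), e ∉ ω} with hB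
  set S : Finset (Site d) := (box d (N + 1)).filter fun z => ∃ y, y ∉ box d N ∧
    ReflTransGen (starRel {w | w ∉ box d N ∨ w ∈ B}) z y with hSdef
  have hS : ∀ z, z ∈ S ↔ z ∈ box d (N + 1) ∧ ∃ y, y ∉ box d N ∧
      ReflTransGen (starRel {w | w ∉ box d N ∨ w ∈ B}) z y := fun z => by rw [hSdef, mem_filter]
  have hw5 : ∀ x ∈ inBoundary K₀, x ∉ B := fun x hx ⟨e, he, heω⟩ => heω (h5 x hx e he)
  have hw5' : ∀ x ∈ inBoundary K₀', x ∉ B := fun x hx ⟨e, he, heω⟩ => heω (h5' x hx e he)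
  have hK := (cavity_eq_of_sleeve hd hS h1 h3 h4 hw5 h6).2
  have hK' := (cavity_eq_of_sleeve hd hS h1' h3' h4' hw5' h6').2
  exact hne (hK.symm.trans hK')

/-- **Grimmett's claim (c): the sleeve event of `K₀` is determined by the colours of the layer
`(Λ_N ∖ K₀) ∪ ∂^in_★ K₀`**, i.e. by the lattice edges with an endpoint in a `★`-ball of a site of that layer — a set of
edges disjoint from `E(core K₀)` (`disjoint_biUnion_edgesTouching_starBall_edgesIn_core`).
[cite: Grimmett2006, §5.3 proof of Thm. (5.33)(b), claim (c) p. 109] -/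
theorem determinedBy_setOf_sleeve (K₀ : Finset (Site d)) :
    DeterminedBy
      {ω : BondConfig (Site d) | StarConn (↑K₀ : Set (Site d)) ∧ StarConn (↑K₀ : Set (Site d))ᶜ ∧ (0 : Site d) ∈ K₀ ∧
        K₀ ⊆ box d N ∧ (∀ x ∈ inBoundary K₀, ∀ e ∈ edgesTouching (zdGraph d) (starBall x), e ∈ ω) ∧
        ∀ y ∈ exBoundary K₀, ∃ y', y' ∉ box d N ∧ ReflTransGen (starRel {w | w ∉ K₀ ∧
          (w ∉ box d N ∨ ∃ e ∈ edgesTouching (zdGraph d) (starBall w), e ∉ ω)}) y y'}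
      ↑(((box d N \ K₀) ∪ inBoundary K₀).biUnion fun z => edgesTouching (zdGraph d) (starBall z)) := by
  rw [determinedBy_iff]
  intro ω ω' hωω'
  -- the edges of the layer carry the same states in `ω` and `ω'`
  have hagree : ∀ z ∈ (box d N \ K₀) ∪ inBoundary K₀, ∀ e ∈ edgesTouching (zdGraph d) (starBall z), e ∈ ω ↔ e ∈ ω' := by
    intro z hz e he
    have heT : e ∈ (↑(((box d N \ K₀) ∪ inBoundary K₀).biUnion fun z => edgesTouching (zdGraph d) (starBall z)) :
        Set (Sym2 (Site d))) := mem_coe.2 (mem_biUnion.2 ⟨z, hz, he⟩)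
    constructor
    · intro h; exact ((Set.ext_iff.1 hωω' e).1 ⟨h, heT⟩).1
    · intro h; exact ((Set.ext_iff.1 hωω' e).2 ⟨h, heT⟩).1
  -- hence the same sleeve colours and the same black-or-outside sites off `K₀`
  have hsleeve : (∀ x ∈ inBoundary K₀, ∀ e ∈ edgesTouching (zdGraph d) (starBall x), e ∈ ω) ↔
      ∀ x ∈ inBoundary K₀, ∀ e ∈ edgesTouching (zdGraph d) (starBall x), e ∈ ω' :=
    ⟨fun h x hx e he => (hagree x (mem_union_right _ hx) e he).1 (h x hx e he),
      fun h x hx e he => (hagree x (mem_union_right _ hx) e he).2 (h x hx e he)⟩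
  have hset : {w : Site d | w ∉ K₀ ∧ (w ∉ box d N ∨ ∃ e ∈ edgesTouching (zdGraph d) (starBall w), e ∉ ω)} =
      {w : Site d | w ∉ K₀ ∧ (w ∉ box d N ∨ ∃ e ∈ edgesTouching (zdGraph d) (starBall w), e ∉ ω')} := by
    ext w
    simp only [Set.mem_setOf_eq]
    refine and_congr_right fun hwK => ?_
    by_cases hwN : w ∈ box d N
    · have hz : w ∈ (box d N \ K₀) ∪ inBoundary K₀ := mem_union_left _ (mem_sdiff.2 ⟨hwN, hwK⟩)
      constructor
      · rintro (h | ⟨e, he, heω⟩)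
        · exact Or.inl h
        · exact Or.inr ⟨e, he, fun h' => heω ((hagree w hz e he).2 h')⟩
      · rintro (h | ⟨e, he, heω⟩)
        · exact Or.inl h
        · exact Or.inr ⟨e, he, fun h' => heω ((hagree w hz e he).1 h')⟩
    · simp [hwN]
  simp only [Set.mem_setOf_eq]
  rw [hsleeve, hset]

/-- The sleeve event of `K₀` is a local event (hence measurable). [cite: Grimmett2006, §5.3 proof of Thm. (5.33)(b), claim (c)] -/
theorem isLocalEvent_setOf_sleeve (K₀ : Finset (Site d)) :
    IsLocalEvent
      {ω : BondConfig (Site d) | StarConn (↑K₀ : Set (Site d)) ∧ StarConn (↑K₀ : Set (Site d))ᶜ ∧ (0 : Site d) ∈ K₀ ∧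
        K₀ ⊆ box d N ∧ (∀ x ∈ inBoundary K₀, ∀ e ∈ edgesTouching (zdGraph d) (starBall x), e ∈ ω) ∧
        ∀ y ∈ exBoundary K₀, ∃ y', y' ∉ box d N ∧ ReflTransGen (starRel {w | w ∉ K₀ ∧
          (w ∉ box d N ∨ ∃ e ∈ edgesTouching (zdGraph d) (starBall w), e ∉ ω)}) y y'} :=
  Exists.intro _ (determinedBy_setOf_sleeve K₀)

/-- The layer `(Λ_N ∖ K₀) ∪ ∂^in_★ K₀` lies off `K₀` or in `∂^in_★ K₀` (hypothesis of
`disjoint_biUnion_edgesTouching_starBall_edgesIn_core`). [folklore] -/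
theorem layer_subset (K₀ : Finset (Site d)) : ∀ z ∈ (box d N \ K₀) ∪ inBoundary K₀, z ∉ K₀ ∨ z ∈ inBoundary K₀ := by
  intro z hz
  rcases mem_union.1 hz with h | h
  · exact Or.inl (mem_sdiff.1 h).2
  · exact Or.inr h

/-- **Covering**: if NO site of `Λ_{m+2}` is `★`-chained to `Λ_Nᶜ` through black-or-outside sites (`m + 2 ≤ N`,
`d ≥ 2`), the configuration lies in the sleeve event of some candidate `K₀` with `Λ_{m+2} ⊆ K₀ ⊆ Λ_N` — namely its
cavity `K = starIntComp S 0` (`sleeve_of_cavity`; `Λ_{m+2}` is `★`-connected, avoids `S` and contains `0`). This is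
Grimmett's "Assume that `K_{Λ,Δ}` occurs, so that `I ⊇ Λ`". [cite: Grimmett2006, §5.3 proof of Thm. (5.33)(b), (5.37)–(5.38)] -/
theorem setOf_forall_not_chain_subset_biUnion_sleeve (hd : 2 ≤ d) {m : ℕ} (hmN : m + 2 ≤ N) :
    {ω : BondConfig (Site d) | ∀ z ∈ box d (m + 2), ¬ ∃ y, y ∉ box d N ∧ ReflTransGen (starRel {w | w ∉ box d N ∨
        ∃ e ∈ edgesTouching (zdGraph d) (starBall w), e ∉ ω}) z y} ⊆
      ⋃ K₀ ∈ (box d N).powerset.filter (fun K₀ => box d (m + 2) ⊆ K₀),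
        {ω : BondConfig (Site d) | StarConn (↑K₀ : Set (Site d)) ∧ StarConn (↑K₀ : Set (Site d))ᶜ ∧ (0 : Site d) ∈ K₀ ∧
          K₀ ⊆ box d N ∧ (∀ x ∈ inBoundary K₀, ∀ e ∈ edgesTouching (zdGraph d) (starBall x), e ∈ ω) ∧
          ∀ y ∈ exBoundary K₀, ∃ y', y' ∉ box d N ∧ ReflTransGen (starRel {w | w ∉ K₀ ∧
            (w ∉ box d N ∨ ∃ e ∈ edgesTouching (zdGraph d) (starBall w), e ∉ ω)}) y y'} := by
  classical
  intro ω hω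
  set B : Set (Site d) := {w | ∃ e ∈ edgesTouching (zdGraph d) (starBall w), e ∉ ω} with hB
  set S : Finset (Site d) := (box d (N + 1)).filter fun z => ∃ y, y ∉ box d N ∧
    ReflTransGen (starRel {w | w ∉ box d N ∨ w ∈ B}) z y with hSdef
  have hS : ∀ z, z ∈ S ↔ z ∈ box d (N + 1) ∧ ∃ y, y ∉ box d N ∧
      ReflTransGen (starRel {w | w ∉ box d N ∨ w ∈ B}) z y := fun z => by rw [hSdef, mem_filter]
  -- `Λ_{m+2}` avoids `S`
  have havoid : ∀ z ∈ box d (m + 2), z ∉ S := fun z hz hzS => hω z hz ((hS z).1 hzS).2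
  have hmN' : box d (m + 2) ⊆ box d N := box_mono d hmN
  have h0S : (0 : Site d) ∉ S := havoid 0 (zero_mem_box d (m + 2))
  obtain ⟨h1, h2, h3, h4, h5, h6⟩ := sleeve_of_cavity hd hS h0S
  have hSbox := blackCluster_subset_box hS
  have hshell : box d (N + 1) \ box d N ⊆ S := fun z hz => mem_blackCluster_of_mem_shell hS hz
  have h0int : (0 : Site d) ∈ starInt S := mem_starInt_of_shell_subset hd hSbox hshell (zero_mem_box d N) h0S
  have hbox : box d (m + 2) ⊆ starIntComp S 0 := by
    have h := subset_starIntComp_of_starConn hd (starConn_box (m + 2))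
      (Set.disjoint_left.2 fun z hz hzS => havoid z (mem_coe.1 hz) (mem_coe.1 hzS)) (mem_coe.2 (zero_mem_box d (m + 2))) h0int
    exact fun z hz => mem_coe.1 (h (mem_coe.2 hz))
  simp only [Set.mem_iUnion, mem_filter, mem_powerset, exists_prop]
  refine ⟨starIntComp S 0, ⟨h4, hbox⟩, h1, h2, h3, h4, fun x hx e he => ?_, fun y hy => ?_⟩
  · by_contra heω
    exact h5 x hx ⟨e, he, heω⟩
  · obtain ⟨y', hy', hchain⟩ := h6 y hy
    exact ⟨y', hy', hchain⟩

end Events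

end Summit.CriticalPhenomena.PercolationContinuityZ3.Theorems.FK

end
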